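import Literature.NumberTheory.ModularSymbols.CuspidalHomologyShiftSubOneFibre
import HarnessLib

/-!
# `V₁(𝔽₃) = Λ₁/3Λ₁`: the quotient map `Λ → Λ₁`, mod-3 exactness `ker(1 − t̄) = im(1 − t̄)`, the
# `χ₋₃`-semilinearity of `1 − t̄`, and mod-3 saturation from the vanishing of a twisted eigen-piece

Second sequel of `CuspidalHomologyShiftNorm` (p661679 · p662714) after `CuspidalHomologyShiftSubOneFibre`
(p665446), typed for bsd-stepL LINE 28 (bsd-idea-3 memo §13.10 (ii), the step "`(Φ₁)_𝔪 = 0 ⟹ (V₁)_{𝔪*} ⊆ εV₁`",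
and §13.9 (L3)). Everything is proved; no named facts, no instances, no notation.

Notation: `Λ = periodHomologyHecke N = H₁(X₀(N), ℤ)`, `t = shiftInt` (`9 ∣ N`), `Λ₁ = shiftSubOneLattice = (t − 1)Λ`,
`V₁(R) = ShiftSubOneModule N h9 R = R ⊗ Λ₁`, `t̄ = shiftOneR`, `T̄_p = heckeOneR` (`p ≠ 3`), `ε = 1 − t̄`.

* §1 `toShiftSubOne : Λ → Λ₁`, `y ↦ t y − y` (onto, kernel `Λ_B = fixedLattice`; `t`-equivariant;
  `T_p`-equivariant for `p ≡ 1 (mod 3)` and `χ₋₃`-SEMILINEAR for `p ≡ 2`: `(t − 1)(T_p y) = T_p((t + 1)(t − 1)y)`),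
  so that `Λ₁ ≅ Λ/Λ_B` semilinearly (memo §13.10: "`(t − 1) : Λ/Λ_B ≅ Λ₁`", `Λ₁ ⊗ ℝ/Λ₁ ≅ J₀(N)/B`).
* §2 On `V₁(𝔽₃)`: `ε² = 0` (`(1 − t)² = −3t` on `Λ₁`) and **mod-3 exactness `ker ε = im ε`**
  (`ker_one_sub_shiftOneR_eq_range`, from the lattice statement
  `exists_sub_shiftInt_eq_three_smul_iff_of_mem_shiftSubOneLattice` of p662714 via the fibre map of p665446:
  onto, kernel `3Λ₁`); so `V₁(𝔽₃) ≅ (𝔽₃[ε]/ε²)^d` and `Φ₁ := ker ε = εV₁`.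
* §3 Semilinearity of `ε` (any `R`): `T̄_p ε = ε T̄_p` (`p ≡ 1`), `T̄_p ε = (1 + t̄) ε T̄_p` (`p ≡ 2`); over `𝔽₃`,
  where `t̄ = 1` on `εV₁ = ker ε`, this is **`T̄_p ε = χ₋₃(p) ε T̄_p`** (`heckeOneR_one_sub_shiftOneR_apply_eq_twist`),
  `χ₋₃(p) = ±1` for `p ≡ ±1 (mod 3)` (`twistSign`), hence `ε` carries the generalised eigenspace `V₁[a^∞]` into
  `V₁[(χa)^∞]` (`one_sub_shiftOneR_apply_mem_genIsotypicOne_twist`).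
* §4 **Mod-3 saturation from a vanishing** (`genIsotypicOne_le_range_of_inf_ker_eq_bot`): if the `χa`-generalised
  eigenspace meets `Φ₁ = ker ε` trivially (`V₁[(χa)^∞] ∩ Φ₁ = 0`, i.e. "`(Φ₁)_𝔪 = 0`" for `𝔪 ↔ χa`), then
  `V₁[a^∞] ⊆ εV₁` — bsd-idea-3's `ModThreeSaturation N h9 S a` — which by the Theorems-side `PS_of` gives period
  saturation. So LINE 28's mod-3 input is reduced to the single vanishing `V₁(𝔽₃)[(χa)^∞] ∩ ker(1 − t̄) = 0`
  (`a = ` the system of `f_{III*}`, `χa` that of `f_{III} = f_{III*} ⊗ χ₋₃`).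

## References

* M. Harrison, the `X₀(108)` / shift-by-`1/3` computations, 2011, §2 (the shift `t` and its commutation with `T_p`).
* F. Diamond, J. Shurman, *A First Course in Modular Forms*, GTM 228, 2005, Prop. 5.2.2(a), §6.3.
* U. Stammbach, *Homology in Group Theory*, LNM 359, 1973, II.3 (3.11) (`ℤ/n ⊗ A = A/nA`).
* N. Jacobson, *Basic Algebra II*, 1989, §3.4 (generalised eigenspaces / Fitting).
-/

noncomputable section

namespace Literature.NumberTheory.ModularSymbols

open Literature.NumberTheory.EllipticCurves Literature.NumberTheory.EllipticCurves.ModularForms CongruenceSubgroup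
open scoped TensorProduct

/-! ### §1 The quotient map `Λ → Λ₁`, `y ↦ (t − 1)y` -/

section HomologyToShiftSubOne

variable (N : ℕ) [NeZero N] (h9 : 3 ^ 2 ∣ N)

/-- **`Λ → Λ₁`, `y ↦ t y − y`** (the map `t_* − 1` with its image as codomain). [cite: Harrison2011X0108, §2] -/
def toShiftSubOne : periodHomologyHecke N →ₗ[ℤ] shiftSubOneLattice N h9 :=
  LinearMap.codRestrict (shiftSubOneLattice N h9) (shiftInt N h9 - 1) fun y ↦ LinearMap.mem_range_self _ y

/-- Unfolding `toShiftSubOne`: its value is `t y − y`. [cite: Harrison2011X0108, §2] -/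
@[simp] theorem coe_toShiftSubOne (y : periodHomologyHecke N) :
    ((toShiftSubOne N h9 y : shiftSubOneLattice N h9) : periodHomologyHecke N) = shiftInt N h9 y - y :=
  rfl

/-- `Λ → Λ₁` is onto (`Λ₁ = (t − 1)Λ` by definition). [cite: Harrison2011X0108, §2] -/
theorem toShiftSubOne_surjective : Function.Surjective (toShiftSubOne N h9) := by
  rintro ⟨x, hx⟩
  obtain ⟨y, rfl⟩ := (mem_shiftSubOneLattice_iff N h9 x).mp hx
  exact ⟨y, Subtype.ext rfl⟩

/-- **The kernel of `Λ → Λ₁` is the fixed lattice `Λ_B = ker(t − 1)`** (so `Λ₁ ≅ Λ/Λ_B`, memo §13.10).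
[cite: Harrison2011X0108, §2 (derived reading)] -/
theorem toShiftSubOne_eq_zero_iff (y : periodHomologyHecke N) :
    toShiftSubOne N h9 y = 0 ↔ y ∈ fixedLattice N h9 := by
  rw [mem_fixedLattice_iff, Subtype.ext_iff, coe_toShiftSubOne, Submodule.coe_zero, sub_eq_zero]

/-- The kernel of `Λ → Λ₁` as a submodule: `fixedLattice`. [cite: Harrison2011X0108, §2 (derived reading)] -/
theorem ker_toShiftSubOne : LinearMap.ker (toShiftSubOne N h9) = fixedLattice N h9 := by
  ext y
  rw [LinearMap.mem_ker, toShiftSubOne_eq_zero_iff]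

/-- `Λ → Λ₁` intertwines `t` with `t|_{Λ₁}`. [cite: Harrison2011X0108, §2] -/
theorem toShiftSubOne_shiftInt (y : periodHomologyHecke N) :
    toShiftSubOne N h9 (shiftInt N h9 y) = shiftOne N h9 (toShiftSubOne N h9 y) := by
  apply Subtype.ext
  simp only [coe_toShiftSubOne, coe_shiftOne, map_sub]

variable {N} in
/-- `Λ → Λ₁` intertwines `T_p` with `T_p|_{Λ₁}` for `p ≡ 1 (mod 3)` (`t T_p = T_p t`).
[cite: DiamondShurman2005, Prop. 5.2.2(a) (derived reading, see `shiftInt_smul_T_of_mod_three_eq_one`)] -/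
theorem toShiftSubOne_T_smul_of_mod_three_eq_one {p : ℕ} (hp : p.Prime) (hp3 : p ≠ 3) (hp1 : p % 3 = 1)
    (y : periodHomologyHecke N) :
    toShiftSubOne N h9 (HeckeRing0.T N 2 p hp • y) = heckeOne h9 hp hp3 (toShiftSubOne N h9 y) := by
  apply Subtype.ext
  simp only [coe_toShiftSubOne, coe_heckeOne, smul_sub, shiftInt_smul_T_of_mod_three_eq_one N h9 hp hp1]

variable {N} in
/-- **`Λ → Λ₁` is `χ₋₃`-semilinear at `p ≡ 2 (mod 3)`**: `(t − 1)(T_p y) = T_p((t + 1)(t − 1)y)`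
(`t T_p = T_p t²`, so `(t − 1)T_p = T_p(t² − 1) = T_p (t + 1)(t − 1)`; on the quotient where `t = 1` this is
`T_p ∘ (t − 1) = −(t − 1) ∘ T_p` up to `3`). [cite: DiamondShurman2005, Prop. 5.2.2(a) (derived reading, see `shiftInt_smul_T_of_mod_three_eq_two`)] -/
theorem toShiftSubOne_T_smul_of_mod_three_eq_two {p : ℕ} (hp : p.Prime) (hp3 : p ≠ 3) (hp2 : p % 3 = 2)
    (y : periodHomologyHecke N) :
    toShiftSubOne N h9 (HeckeRing0.T N 2 p hp • y) =
      heckeOne h9 hp hp3 (shiftOne N h9 (toShiftSubOne N h9 y) + toShiftSubOne N h9 y) := by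
  apply Subtype.ext
  simp only [coe_toShiftSubOne, coe_heckeOne, Submodule.coe_add, coe_shiftOne, map_sub]
  have e : shiftInt N h9 (shiftInt N h9 y) - shiftInt N h9 y + (shiftInt N h9 y - y) =
      shiftInt N h9 (shiftInt N h9 y) - y := by abel
  rw [e, smul_sub, shiftInt_smul_T_of_mod_three_eq_two N h9 hp hp2]

variable (R : Type*) [CommRing R]

/-- The composite **`Λ → V₁(R)`, `y ↦ 1 ⊗ (t y − y)`** (reduction of `Λ/Λ_B ≅ Λ₁` to the fibre; for `R = ℤ/n`
this realises `V₁(ℤ/n)` as the quotient `Λ/(Λ_B + nΛ)`, the lattice avatar of `(J₀(N)/B)[n] = J[n]/B[n]`).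
[cite: HatcherAT2002, §3.A Cor. 3A.4 (derived reading, with Harrison 2011 §2 for t)] -/
def toFibreOfHomology : periodHomologyHecke N →ₗ[ℤ] ShiftSubOneModule N h9 R :=
  (toFibre N h9 R).comp (toShiftSubOne N h9)

/-- Unfolding `toFibreOfHomology`. [cite: HatcherAT2002, §3.A Cor. 3A.4 (derived reading)] -/
@[simp] theorem toFibreOfHomology_apply (y : periodHomologyHecke N) :
    toFibreOfHomology N h9 R y = toFibre N h9 R (toShiftSubOne N h9 y) :=
  rfl

/-- `Λ → V₁(ℤ/n)` is onto. [cite: Stammbach1973HomologyGroupTheory, II.3 (3.11) (derived reading)] -/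
theorem toFibreOfHomology_zmod_surjective (n : ℕ) : Function.Surjective (toFibreOfHomology N h9 (ZMod n)) :=
  (toFibre_zmod_surjective N h9 n).comp (toShiftSubOne_surjective N h9)

/-- **Kernel of `Λ → V₁(ℤ/n)`**: `y ↦ 0` iff `y ∈ Λ_B + nΛ`, i.e. iff `y − n z ∈ Λ_B` for some `z ∈ Λ`
(`V₁(ℤ/n) = Λ/(Λ_B + nΛ)`). [cite: Stammbach1973HomologyGroupTheory, II.3 (3.11) (derived reading: kernel nΛ₁ of the fibre map + kernel Λ_B of t − 1)] -/
theorem toFibreOfHomology_zmod_eq_zero_iff (n : ℕ) (y : periodHomologyHecke N) :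
    toFibreOfHomology N h9 (ZMod n) y = 0 ↔ ∃ z : periodHomologyHecke N, y - (n : ℤ) • z ∈ fixedLattice N h9 := by
  rw [toFibreOfHomology_apply, toFibre_zmod_eq_zero_iff]
  constructor
  · rintro ⟨w, hw⟩
    obtain ⟨z, hz⟩ := toShiftSubOne_surjective N h9 w
    refine ⟨z, ?_⟩
    rw [← toShiftSubOne_eq_zero_iff, map_sub, map_zsmul, hz, hw, sub_self]
  · rintro ⟨z, hz⟩
    refine ⟨toShiftSubOne N h9 z, ?_⟩
    rw [← toShiftSubOne_eq_zero_iff, map_sub, map_zsmul] at hz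
    rw [← sub_eq_zero]
    have : (n : ℤ) • toShiftSubOne N h9 z - toShiftSubOne N h9 y = -(toShiftSubOne N h9 y - (n : ℤ) • toShiftSubOne N h9 z) := by
      abel
    rw [this, hz, neg_zero]

end HomologyToShiftSubOne

/-! ### §2 `V₁(𝔽₃)`: `ε² = 0` and mod-3 exactness `ker ε = im ε` for `ε = 1 − t̄` -/

section ModThree

variable (N : ℕ) [NeZero N] (h9 : 3 ^ 2 ∣ N)

set_option maxHeartbeats 400000 in
variable (R : Type*) [CommRing R] in
/-- `(1 − t̄)(1 ⊗ x) = 1 ⊗ (1 − t)x`. [cite: Harrison2011X0108, §2] -/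
theorem one_sub_shiftOneR_toFibre (x : shiftSubOneLattice N h9) :
    (1 - shiftOneR N h9 R) (toFibre N h9 R x) = toFibre N h9 R ((1 - shiftOne N h9) x) := by
  rw [LinearMap.sub_apply, Module.End.one_apply, LinearMap.sub_apply, Module.End.one_apply, map_sub,
    toFibre_shiftOne]

/-- **`ε² = 0` on `V₁(𝔽₃)`** (`ε = 1 − t̄`): `(1 − t)² = −3t` on `Λ₁` (`one_sub_shiftOne_sq_apply`) and `3 = 0`.
[cite: Harrison2011X0108, §2 (derived reading via (1 − t)² = −3t on ker(1 + t + t²))] -/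
theorem one_sub_shiftOneR_sq_apply_eq_zero (v : ShiftSubOneModule N h9 (ZMod 3)) :
    (1 - shiftOneR N h9 (ZMod 3)) ((1 - shiftOneR N h9 (ZMod 3)) v) = 0 := by
  obtain ⟨x, rfl⟩ := toFibre_zmod_surjective N h9 3 v
  rw [one_sub_shiftOneR_toFibre, one_sub_shiftOneR_toFibre, one_sub_shiftOne_sq_apply, map_neg,
    ← Nat.cast_smul_eq_nsmul ℤ, ← intCast_smul_toFibre]
  have h3 : (((3 : ℕ) : ℤ) : ZMod 3) = 0 := by decide
  rw [h3, zero_smul, neg_zero]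

/-- `im ε ⊆ ker ε` on `V₁(𝔽₃)`. [cite: Harrison2011X0108, §2 (derived reading)] -/
theorem range_one_sub_shiftOneR_le_ker :
    LinearMap.range (1 - shiftOneR N h9 (ZMod 3)) ≤ LinearMap.ker (1 - shiftOneR N h9 (ZMod 3)) := by
  rintro _ ⟨v, rfl⟩
  exact one_sub_shiftOneR_sq_apply_eq_zero N h9 v

/-- **Mod-3 exactness on `V₁(𝔽₃)`: `ker(1 − t̄) = im(1 − t̄)`** (so `V₁(𝔽₃) ≅ (𝔽₃[ε]/ε²)^d` with `Φ₁ := ker ε = εV₁`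
of half dimension). From the lattice statement `exists_sub_shiftInt_eq_three_smul_iff_of_mem_shiftSubOneLattice`
(p662714) through the fibre map (onto, kernel `3Λ₁`, p665446). [cite: Harrison2011X0108, §2 (derived reading: (1 − t)² = −3t and 3-torsion-freeness of Λ₁)] -/
theorem ker_one_sub_shiftOneR_eq_range :
    LinearMap.ker (1 - shiftOneR N h9 (ZMod 3)) = LinearMap.range (1 - shiftOneR N h9 (ZMod 3)) := by
  refine le_antisymm ?_ (range_one_sub_shiftOneR_le_ker N h9)
  intro v hv
  obtain ⟨x, rfl⟩ := toFibre_zmod_surjective N h9 3 v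
  rw [LinearMap.mem_ker, one_sub_shiftOneR_toFibre, toFibre_zmod_eq_zero_iff] at hv
  obtain ⟨y, hy⟩ := hv
  -- lattice statement: `(1 − t)x ∈ 3Λ₁ ⟹ x ∈ (1 − t)Λ₁`
  have hx3 : ∃ y' ∈ shiftSubOneLattice N h9, (1 - shiftInt N h9) (x : periodHomologyHecke N) = 3 • y' := by
    refine ⟨y, y.2, ?_⟩
    have h := congrArg (fun z : shiftSubOneLattice N h9 ↦ (z : periodHomologyHecke N)) hy
    simp only [Submodule.coe_smul_of_tower, LinearMap.sub_apply, Module.End.one_apply, Submodule.coe_sub,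
      coe_shiftOne] at h
    rw [LinearMap.sub_apply, Module.End.one_apply, ← h, ← Nat.cast_smul_eq_nsmul ℤ, Nat.cast_ofNat]
  obtain ⟨z, hz, hxz⟩ := (exists_sub_shiftInt_eq_three_smul_iff_of_mem_shiftSubOneLattice N h9 x.2).mp hx3
  refine ⟨toFibre N h9 (ZMod 3) ⟨z, hz⟩, ?_⟩
  rw [one_sub_shiftOneR_toFibre]
  congr 1
  apply Subtype.ext
  rw [hxz]
  simp only [LinearMap.sub_apply, Module.End.one_apply, Submodule.coe_sub, coe_shiftOne]

/-- `Φ₁ = ker(1 − t̄)` is where `t̄` acts trivially: `t̄ w = w` for `w ∈ im(1 − t̄)` (over `𝔽₃`).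
[cite: Harrison2011X0108, §2 (derived reading)] -/
theorem shiftOneR_apply_eq_self_of_mem_range {w : ShiftSubOneModule N h9 (ZMod 3)}
    (hw : w ∈ LinearMap.range (1 - shiftOneR N h9 (ZMod 3))) : shiftOneR N h9 (ZMod 3) w = w := by
  have h := range_one_sub_shiftOneR_le_ker N h9 hw
  rw [LinearMap.mem_ker, LinearMap.sub_apply, Module.End.one_apply, sub_eq_zero] at h
  exact h.symm

end ModThree

/-! ### §3 Semilinearity of `ε = 1 − t̄` with respect to the `T̄_p` -/

section Semilinear

-- pointwise identities on the tensor carrier `R ⊗ ↥(range (t_* − 1))` are whnf-heavy (cf. p662714, p665446)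
set_option maxHeartbeats 800000

variable (N : ℕ) [NeZero N] (h9 : 3 ^ 2 ∣ N) (R : Type*) [CommRing R]

variable {N} in
/-- `T_p t = t² T_p` on `Λ₁` for `p ≡ 2 (mod 3)` (the tree's `smul_T_shiftInt_of_mod_three_eq_two` restricted).
[cite: DiamondShurman2005, Prop. 5.2.2(a) (derived reading, see `smul_T_shiftInt_of_mod_three_eq_two`)] -/
theorem heckeOne_shiftOne_of_mod_three_eq_two {p : ℕ} (hp : p.Prime) (hp3 : p ≠ 3) (hp2 : p % 3 = 2)
    (x : shiftSubOneLattice N h9) :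
    heckeOne h9 hp hp3 (shiftOne N h9 x) = shiftOne N h9 (shiftOne N h9 (heckeOne h9 hp hp3 x)) :=
  Subtype.ext (smul_T_shiftInt_of_mod_three_eq_two N h9 hp hp2 _)

variable {N R} in
/-- `T̄_p ε = ε T̄_p` for `p ≡ 1 (mod 3)` (`ε = 1 − t̄` on `V₁(R)`). [cite: DiamondShurman2005, Prop. 5.2.2(a) (derived reading)] -/
theorem heckeOneR_comp_one_sub_shiftOneR_of_mod_three_eq_one {p : ℕ} (hp : p.Prime) (hp3 : p ≠ 3)
    (hp1 : p % 3 = 1) :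
    heckeOneR h9 hp hp3 (R := R) ∘ₗ (1 - shiftOneR N h9 R) = (1 - shiftOneR N h9 R) ∘ₗ heckeOneR h9 hp hp3 := by
  refine TensorProduct.AlgebraTensorModule.ext fun r x ↦ ?_
  simp only [LinearMap.comp_apply, LinearMap.sub_apply, Module.End.one_apply, map_sub, heckeOneR_tmul,
    shiftOneR_tmul, shiftOne_heckeOne_of_mod_three_eq_one h9 hp hp3 hp1]

variable {N R} in
/-- `T̄_p t̄ = t̄² T̄_p` for `p ≡ 2 (mod 3)` (from `t̄ T̄_p = T̄_p t̄²` and `t̄³ = 1`).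
[cite: DiamondShurman2005, Prop. 5.2.2(a) (derived reading)] -/
theorem heckeOneR_comp_shiftOneR_of_mod_three_eq_two {p : ℕ} (hp : p.Prime) (hp3 : p ≠ 3) (hp2 : p % 3 = 2) :
    heckeOneR h9 hp hp3 (R := R) ∘ₗ shiftOneR N h9 R =
      shiftOneR N h9 R ∘ₗ shiftOneR N h9 R ∘ₗ heckeOneR h9 hp hp3 := by
  refine TensorProduct.AlgebraTensorModule.ext fun r x ↦ ?_
  simp only [LinearMap.comp_apply, heckeOneR_tmul, shiftOneR_tmul, heckeOne_shiftOne_of_mod_three_eq_two h9 hp hp3 hp2]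

variable {N R} in
/-- **`T̄_p ε = (1 + t̄) ε T̄_p` for `p ≡ 2 (mod 3)`** (`ε = 1 − t̄`; `T̄_p(1 − t̄) = (1 − t̄²)T̄_p`).
[cite: DiamondShurman2005, Prop. 5.2.2(a) (derived reading)] -/
theorem heckeOneR_comp_one_sub_shiftOneR_of_mod_three_eq_two {p : ℕ} (hp : p.Prime) (hp3 : p ≠ 3)
    (hp2 : p % 3 = 2) :
    heckeOneR h9 hp hp3 (R := R) ∘ₗ (1 - shiftOneR N h9 R) =
      (1 + shiftOneR N h9 R) ∘ₗ (1 - shiftOneR N h9 R) ∘ₗ heckeOneR h9 hp hp3 := by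
  refine TensorProduct.AlgebraTensorModule.ext fun r x ↦ ?_
  simp only [LinearMap.comp_apply, LinearMap.sub_apply, LinearMap.add_apply, Module.End.one_apply, map_sub,
    heckeOneR_tmul, shiftOneR_tmul, heckeOne_shiftOne_of_mod_three_eq_two h9 hp hp3 hp2]
  abel

/-- The sign `χ₋₃(p) ∈ R` of a prime `p ≠ 3`: `1` if `p ≡ 1 (mod 3)`, `−1` otherwise. [cite: DiamondShurman2005, §6.3 (bookkeeping definition)] -/
def twistSign (p : ℕ) : R := if p % 3 = 1 then 1 else -1

/-- `χ₋₃(p)² = 1`. [cite: DiamondShurman2005, §6.3 (bookkeeping)] -/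
theorem twistSign_mul_self (p : ℕ) : twistSign R p * twistSign R p = 1 := by
  unfold twistSign
  split_ifs <;> simp

/-- The twisted eigen-system `(χa)_p = χ₋₃(p) a_p`. [cite: DiamondShurman2005, §6.3 (bookkeeping definition)] -/
def twistSystem (a : ℕ → R) : ℕ → R := fun p ↦ twistSign R p * a p

/-- Unfolding `twistSystem`. [cite: DiamondShurman2005, §6.3 (bookkeeping)] -/
theorem twistSystem_apply (a : ℕ → R) (p : ℕ) : twistSystem R a p = twistSign R p * a p :=
  rfl

/-- `χ(χa) = a`. [cite: DiamondShurman2005, §6.3 (bookkeeping)] -/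
theorem twistSystem_twistSystem (a : ℕ → R) : twistSystem R (twistSystem R a) = a := by
  funext p
  rw [twistSystem_apply, twistSystem_apply, ← mul_assoc, twistSign_mul_self, one_mul]

variable {N} in
/-- **`T̄_p ε v = χ₋₃(p) · ε T̄_p v` on `V₁(𝔽₃)`** (`ε = 1 − t̄`; for `p ≡ 2` use `T̄_p ε = (1 + t̄)ε T̄_p` and
`t̄ = 1` on `εV₁ = ker ε`, so `1 + t̄ = 2 = −1` there). This is (L3) of bsd-idea-3 memo §13.9 on the fibre.
[cite: DiamondShurman2005, Prop. 5.2.2(a) (derived reading; the χ₋₃-semilinearity of 1 − t̄, bsd-idea-3 memo §13.9 (L3))] -/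
theorem heckeOneR_one_sub_shiftOneR_apply_eq_twist {p : ℕ} (hp : p.Prime) (hp3 : p ≠ 3)
    (v : ShiftSubOneModule N h9 (ZMod 3)) :
    heckeOneR h9 hp hp3 ((1 - shiftOneR N h9 (ZMod 3)) v) =
      twistSign (ZMod 3) p • (1 - shiftOneR N h9 (ZMod 3)) (heckeOneR h9 hp hp3 v) := by
  have hmod : p % 3 = 1 ∨ p % 3 = 2 := by
    have h0 : p % 3 ≠ 0 := fun h0 ↦
      hp3 ((Nat.prime_dvd_prime_iff_eq Nat.prime_three hp).mp (Nat.dvd_of_mod_eq_zero h0)).symm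
    have hlt : p % 3 < 3 := Nat.mod_lt _ (by norm_num)
    omega
  rcases hmod with h1 | h2
  · have hs : twistSign (ZMod 3) p = 1 := by rw [twistSign, if_pos h1]
    have h := LinearMap.congr_fun
      (heckeOneR_comp_one_sub_shiftOneR_of_mod_three_eq_one h9 hp hp3 h1 (R := ZMod 3)) v
    simp only [LinearMap.comp_apply] at h
    rw [hs, one_smul]
    exact h
  · have hs : twistSign (ZMod 3) p = 2 := by
      rw [twistSign, if_neg (by omega)]
      decide
    have h := LinearMap.congr_fun
      (heckeOneR_comp_one_sub_shiftOneR_of_mod_three_eq_two h9 hp hp3 h2 (R := ZMod 3)) v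
    simp only [LinearMap.comp_apply, LinearMap.add_apply, Module.End.one_apply] at h
    have hw : shiftOneR N h9 (ZMod 3) ((1 - shiftOneR N h9 (ZMod 3)) (heckeOneR h9 hp hp3 v)) =
        (1 - shiftOneR N h9 (ZMod 3)) (heckeOneR h9 hp hp3 v) :=
      shiftOneR_apply_eq_self_of_mem_range N h9 (LinearMap.mem_range_self _ _)
    rw [hw] at h
    rw [h, hs, two_smul]

/-- Generic twisted functoriality of generalised eigenspaces (any commutative ring, any modules — kept off the
tensor carrier so that it elaborates cheaply): if `T (f m) = c · f'(T m)` with `c² = 1`, then `T` maps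
`⋃_k ker(f − μ)^k` into `⋃_k ker(f' − cμ)^k`. [folklore] -/
private theorem apply_mem_maxGenEigenspace_of_twist {R₀ : Type*} [CommRing R₀] {M M' : Type*} [AddCommGroup M]
    [Module R₀ M] [AddCommGroup M'] [Module R₀ M'] (T : M →ₗ[R₀] M') (f : Module.End R₀ M) (f' : Module.End R₀ M')
    (c : R₀) (hc : c * c = 1) (hT : ∀ m, T (f m) = c • f' (T m)) (μ : R₀) {m : M}
    (hm : m ∈ f.maxGenEigenspace μ) : T m ∈ f'.maxGenEigenspace (c * μ) := by
  have hT' : ∀ m, T ((f - μ • (1 : Module.End R₀ M)) m) = c • (f' - (c * μ) • (1 : Module.End R₀ M')) (T m) := by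
    intro m
    rw [LinearMap.sub_apply, LinearMap.smul_apply, Module.End.one_apply, map_sub, map_smul, hT,
      LinearMap.sub_apply, LinearMap.smul_apply, Module.End.one_apply, smul_sub, smul_smul, ← mul_assoc, hc,
      one_mul]
  have key : ∀ (k : ℕ) (m : M), T (((f - μ • (1 : Module.End R₀ M)) ^ k) m) =
      c ^ k • ((f' - (c * μ) • (1 : Module.End R₀ M')) ^ k) (T m) := by
    intro k
    induction k with
    | zero => intro m; simp
    | succ k ih =>
      intro m
      rw [pow_succ, Module.End.mul_apply, ih, hT', map_smul, smul_smul, pow_succ, pow_succ, Module.End.mul_apply]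
  obtain ⟨k, hk⟩ := (Module.End.mem_maxGenEigenspace _ _ _).mp hm
  refine (Module.End.mem_maxGenEigenspace _ _ _).mpr ⟨k, ?_⟩
  have h := key k m
  rw [hk, map_zero] at h
  -- `c^k` is a unit (`c² = 1`): cancel it
  have h2 : ((f' - (c * μ) • (1 : Module.End R₀ M')) ^ k) (T m) =
      c ^ k • (c ^ k • ((f' - (c * μ) • (1 : Module.End R₀ M')) ^ k) (T m)) := by
    rw [smul_smul, ← mul_pow, hc, one_pow, one_smul]
  rw [h2, ← h, smul_zero]

variable {N} in
/-- `ε T̄_p m = χ₋₃(p) · T̄_p ε m` (the twist relation read from the other side, `χ² = 1`).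
[cite: DiamondShurman2005, Prop. 5.2.2(a) (derived reading via `heckeOneR_one_sub_shiftOneR_apply_eq_twist`)] -/
theorem one_sub_shiftOneR_heckeOneR_apply_eq_twist {p : ℕ} (hp : p.Prime) (hp3 : p ≠ 3)
    (m : ShiftSubOneModule N h9 (ZMod 3)) :
    (1 - shiftOneR N h9 (ZMod 3)) (heckeOneR h9 hp hp3 m) =
      twistSign (ZMod 3) p • heckeOneR h9 hp hp3 ((1 - shiftOneR N h9 (ZMod 3)) m) := by
  rw [heckeOneR_one_sub_shiftOneR_apply_eq_twist h9 hp hp3, smul_smul, twistSign_mul_self, one_smul]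

variable {N} in
/-- **`ε` carries `V₁[a^∞]` into `V₁[(χa)^∞]`** (`ε = 1 − t̄` on `V₁(𝔽₃)`, `(χa)_p = χ₋₃(p)a_p`).
[cite: DiamondShurman2005, §6.3 (derived reading: semilinearity of 1 − t̄, bsd-idea-3 memo §13.9 (L3))] -/
theorem one_sub_shiftOneR_apply_mem_genIsotypicOne_twist {S : Set ℕ} {a : ℕ → ZMod 3}
    {v : ShiftSubOneModule N h9 (ZMod 3)} (hv : v ∈ genIsotypicOne N h9 (ZMod 3) S a) :
    (1 - shiftOneR N h9 (ZMod 3)) v ∈ genIsotypicOne N h9 (ZMod 3) S (twistSystem (ZMod 3) a) := by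
  simp only [genIsotypicOne, Submodule.mem_iInf] at hv ⊢
  intro p hp hp3 hpS
  rw [twistSystem_apply]
  exact apply_mem_maxGenEigenspace_of_twist (1 - shiftOneR N h9 (ZMod 3)) (heckeOneR h9 hp hp3)
    (heckeOneR h9 hp hp3) (twistSign (ZMod 3) p) (twistSign_mul_self (ZMod 3) p)
    (one_sub_shiftOneR_heckeOneR_apply_eq_twist h9 hp hp3) (a p) (hv p hp hp3 hpS)

end Semilinear

/-! ### §4 Mod-3 saturation from the vanishing of the twisted eigen-piece of `Φ₁ = ker(1 − t̄)` -/

section Saturation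

variable (N : ℕ) [NeZero N] (h9 : 3 ^ 2 ∣ N)

/-- **Mod-3 saturation from a vanishing** (bsd-idea-3 memo §13.10 (ii): "`(Φ₁)_𝔪 = 0 ⟹ (V₁)_{𝔪*} ⊆ εV₁`"):
on `V₁(𝔽₃)`, if the `χa`-generalised eigenspace meets `Φ₁ = ker(1 − t̄)` trivially, then the `a`-generalised
eigenspace lies in `im(1 − t̄)` — bsd-idea-3's `ModThreeSaturation N h9 S a`. Proof: for `v ∈ V₁[a^∞]`,
`εv ∈ V₁[(χa)^∞] ∩ im ε = V₁[(χa)^∞] ∩ ker ε = 0`, so `v ∈ ker ε = im ε`. [cite: DiamondShurman2005, §6.3 (derived reading: mod-3 exactness ker ε = im ε and the χ₋₃-semilinearity of ε = 1 − t̄; bsd-idea-3 memo §13.10 (ii))] -/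
theorem genIsotypicOne_le_range_of_inf_ker_eq_bot (S : Set ℕ) (a : ℕ → ZMod 3)
    (h : genIsotypicOne N h9 (ZMod 3) S (twistSystem (ZMod 3) a) ⊓
      LinearMap.ker (1 - shiftOneR N h9 (ZMod 3)) = ⊥) :
    genIsotypicOne N h9 (ZMod 3) S a ≤ LinearMap.range (1 - shiftOneR N h9 (ZMod 3)) := by
  intro v hv
  have h1 : (1 - shiftOneR N h9 (ZMod 3)) v ∈
      genIsotypicOne N h9 (ZMod 3) S (twistSystem (ZMod 3) a) ⊓ LinearMap.ker (1 - shiftOneR N h9 (ZMod 3)) :=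
    ⟨one_sub_shiftOneR_apply_mem_genIsotypicOne_twist h9 hv,
      range_one_sub_shiftOneR_le_ker N h9 (LinearMap.mem_range_self _ v)⟩
  rw [h, Submodule.mem_bot] at h1
  rw [← ker_one_sub_shiftOneR_eq_range, LinearMap.mem_ker, h1]

/-- The same with the vanishing hypothesis on the `a`-side and the conclusion for `χa` (`χχa = a`).
[cite: DiamondShurman2005, §6.3 (derived reading, see `genIsotypicOne_le_range_of_inf_ker_eq_bot`)] -/
theorem genIsotypicOne_twist_le_range_of_inf_ker_eq_bot (S : Set ℕ) (a : ℕ → ZMod 3)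
    (h : genIsotypicOne N h9 (ZMod 3) S a ⊓ LinearMap.ker (1 - shiftOneR N h9 (ZMod 3)) = ⊥) :
    genIsotypicOne N h9 (ZMod 3) S (twistSystem (ZMod 3) a) ≤ LinearMap.range (1 - shiftOneR N h9 (ZMod 3)) :=
  genIsotypicOne_le_range_of_inf_ker_eq_bot N h9 S (twistSystem (ZMod 3) a)
    (by rw [twistSystem_twistSystem]; exact h)

end Saturation

end Literature.NumberTheory.ModularSymbols

end
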